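import Literature.NumberTheory.IwasawaTheory.SymmetricThreeCubicClosureTowerExact
import Literature.NumberTheory.NumberFields.DiscriminantSquareRoot
import Mathlib.FieldTheory.PrimitiveElement
import Mathlib.NumberTheory.Padics.PadicVal.Basic
import HarnessLib

set_option autoImplicit false

/-!
# The quadratic resolvent of a non-Galois cubic field is `ℚ(√d_F)`; `√2 ∉` the Galois closure iff `2·d_F ∉ ℚ²`;
# the exact `S₃` relation of `SymmetricThreeCubicClosureTowerExact` with hypotheses on `F` alone

Topic `NumberTheory/IwasawaTheory` (namespace = path).  THEOREM-ONLY file (no definition, no named fact, no `sorry`), written by the prover seat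
`bsd-line-att-p4` g33 (cell `bsd-f1-sign2`, `--supports` stmt-BirchSwinnertonDyer-22298; closes nothing; BSD is proved for no curve here).  Sequel of
`SymmetricThreeCubicClosureTowerExact.lean` (same seat), whose exact relation `e_n(L) = e_n(k) + 2e_n(F)` took «ANY quadratic `k ≤ L`» and «`√2 ∉ L`»
as data/hypotheses on the Galois closure `L`.  Here both are read on the cubic field `F` itself, through its discriminant `d_F = NumberField.discr F`:

* §1 `card_algHom_eq_finrank_of_isGalois` (`#(F →ₐ[ℚ] L) = [F:ℚ]` for `L/ℚ` Galois receiving `F`), `map_fieldRange_ne_of_pair` and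
  `iSup_fieldRange_eq_top` (the conjugates of `ι(F)` generate the sextic `L`), ★ `exists_sqrt_discr_mem_quadratic` — **every quadratic subfield
  `k ≤ L` contains `δ ∉ ℚ` with `δ² = d_F`**, hence ★ `quadratic_eq_adjoin_sqrt_discr` (**`k = ℚ(δ)`: the resolvent is `ℚ(√d_F)`**, and is unique),
  ★ `not_isSquare_discr_of_not_isGalois` (**the discriminant of a non-Galois cubic field is not a square**), ★ `forall_sq_ne_two_of_not_isSquare_two_mul_discr`
  (**`2·d_F ∉ ℚ² ⟹ √2 ∉ L`**).  Tree inputs: `NumberFields/DiscriminantSquareRoot` (`√d_F` lies in the fixed field of every odd-order subgroup and is moved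
  by some automorphism when the conjugates of `F` generate `L` and `[F:ℚ]! < 2·#Gal`), this seat's `exists_symmetricThree_pair_of_cubic`.
* §2 ★★ `classNumberPExp_galoisClosure_eq_resolvent_add_two_mul_cubic_of_discr` — **`e_n(L) = e_n(k) + 2e_n(F)`** for every non-Galois cubic `F` with
  `2·d_F ∉ ℚ²`, every Galois sextic `L ⊇ ι(F)`, every quadratic `k ≤ L` (`= ℚ(√d_F)`), all cyclotomic `ℤ₂`-towers; `classicalMuVanishes_galoisClosure_iff_cubic_of_discr`
  (`μ₂(L) = 0 ⟺ μ₂(F) = 0`), `classicalLambda_galoisClosure_eq_of_discr` (`λ₂(L) = λ₂(k) + 2λ₂(F)`).  With the tree's closed forms for `λ₂` of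
  `ℚ(√±d)` (att-p3 g31–g32) this prices `λ₂` of the Galois closure of every `S₃`-cubic by the cubic's `λ₂` and `d_F` alone.

References: [Ash2010] §2.3 (2.3.3), Problems 1–3; [Marcus2018] Ch. 2; [Cohen1993] §6.3.3; [DavenportHeilbronn1971] §6; [CaputoNuccio2020] Prop. 3.12;
[Washington1997] §13.1, §13.3; tree: `SymmetricThreeCubicClosureTowerExact`, `NumberFields/DiscriminantSquareRoot`, `CubicFields/CubicResolventClosure`.
-/

noncomputable section

open scoped NumberField Pointwise
open NumberField Field IntermediateField Polynomial Module

namespace Literature.NumberTheory.IwasawaTheory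

open Literature.NumberTheory.EllipticCurves Literature.NumberTheory.EllipticCurves.ZpExtension
  Literature.NumberTheory.GaloisRepresentations Literature.NumberTheory.NumberFields

/-! ### §1 The resolvent is `ℚ(√d_F)`; `√2 ∉ L` iff `2·d_F ∉ ℚ²` -/

section Resolvent

variable {F : Type} [Field F] [NumberField F] (L : Type) [Field L] [NumberField L] [IsGalois ℚ L]

/-- **All `[F : ℚ]` embeddings of `F` land in a Galois field receiving `F`**: `#(F →ₐ[ℚ] L) = [F : ℚ]` (the minimal polynomial of a primitive
element of `F` has a root `ι(θ)` in the normal field `L`, hence splits there). [cite: MilneFT2022, Ch. 3 (normal extensions)] -/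
theorem card_algHom_eq_finrank_of_isGalois (ι : F →ₐ[ℚ] L) : Fintype.card (F →ₐ[ℚ] L) = finrank ℚ F := by
  classical
  let pb := Field.powerBasisOfFiniteOfSeparable ℚ F
  have hsep : IsSeparable ℚ pb.gen := Algebra.IsSeparable.isSeparable ℚ pb.gen
  have hsplit : ((minpoly ℚ pb.gen).map (algebraMap ℚ L)).Splits := by
    rw [← minpoly.algHom_eq ι ι.injective pb.gen]
    exact Normal.splits inferInstance (ι pb.gen)
  rw [Fintype.card_eq_nat_card, AlgHom.natCard_of_powerBasis pb hsep hsplit]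
  exact pb.finrank.symm

omit [IsGalois ℚ L] in
/-- For the `S₃`-pair `σ, τ` of `exists_symmetricThree_pair_of_cubic` (`L^τ = ι(F)`): **`σ(ι(F)) ≠ ι(F)`** — otherwise `σ` would normalise
`Gal(L/ι(F)) = ⟨τ⟩`, forcing `στ = τσ`, while `τσ = σ²τ` and `σ ≠ 1`. [cite: MilneFT2022, Ch. 3 (fundamental theorem of Galois theory)] -/
theorem map_fieldRange_ne_of_pair (hL : finrank ℚ L = 6) (hF : finrank ℚ F = 3) (ι : F →ₐ[ℚ] L)
    {σ τ : L ≃ₐ[ℚ] L} (hτ2 : τ ^ 2 = 1) (hτσ : τ * σ = σ ^ 2 * τ)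
    (hτF : fixedField (Subgroup.zpowers τ) = ι.fieldRange) (hσk : finrank ℚ ↥(fixedField (Subgroup.zpowers σ)) = 2) :
    ι.fieldRange.map (σ : L →ₐ[ℚ] L) ≠ ι.fieldRange := by
  classical
  intro heq
  -- `σ ≠ 1` (its fixed field is a proper subfield) and `τ ≠ 1`
  have hσ1 : σ ≠ 1 := by
    intro h
    have htop : fixedField (Subgroup.zpowers σ) = ⊤ := by
      rw [h, Subgroup.zpowers_one_eq_bot]; exact IntermediateField.fixedField_bot
    rw [htop, IntermediateField.finrank_top', hL] at hσk
    omega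
  have hτ1 : τ ≠ 1 := by
    intro h
    have htop : fixedField (Subgroup.zpowers τ) = ⊤ := by
      rw [h, Subgroup.zpowers_one_eq_bot]; exact IntermediateField.fixedField_bot
    have h3 : finrank ℚ ↥ι.fieldRange = 3 := by
      rw [← hF]; exact (LinearEquiv.finrank_eq (AlgEquiv.ofInjectiveField ι).toLinearEquiv).symm
    rw [← hτF, htop, IntermediateField.finrank_top', hL] at h3
    omega
  -- `σ τ σ⁻¹ ∈ Fix(σ(ι F)) = Fix(ι F) = ⟨τ⟩`
  have hfix : ι.fieldRange.fixingSubgroup = Subgroup.zpowers τ := by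
    rw [← hτF, IntermediateField.fixingSubgroup_fixedField]
  have hmem : σ * τ * σ⁻¹ ∈ Subgroup.zpowers τ := by
    have h1 : σ * τ * σ⁻¹ ∈ MulAut.conj σ • (Subgroup.zpowers τ) :=
      ⟨τ, Subgroup.mem_zpowers τ, by simp [MulAut.conj_apply]⟩
    rwa [← hfix, ← IsGalois.map_fixingSubgroup, heq, hfix] at h1
  have hoτ : orderOf τ = 2 := orderOf_eq_prime hτ2 hτ1
  rw [mem_zpowers_iff_mem_range_orderOf, Finset.mem_image] at hmem
  obtain ⟨i, hi, hconj⟩ := hmem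
  rw [Finset.mem_range, hoτ] at hi
  interval_cases i
  · rw [pow_zero] at hconj
    have h' : σ * τ = σ := mul_inv_eq_one.mp hconj.symm
    exact hτ1 (mul_left_cancel (h'.trans (mul_one σ).symm))
  · rw [pow_one] at hconj
    have hc : σ * τ = τ * σ := mul_inv_eq_iff_eq_mul.mp hconj.symm
    -- `σ τ = τ σ = σ² τ` ⟹ `σ = σ²` ⟹ `σ = 1`
    rw [hτσ] at hc
    have h2 : σ = σ ^ 2 := mul_right_cancel hc
    have : σ = 1 := by
      have h3 : σ * σ = σ * 1 := by rw [mul_one, ← pow_two, ← h2]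
      exact mul_left_cancel h3
    exact hσ1 this

variable (hL : finrank ℚ L = 6) (hF : finrank ℚ F = 3) (hFG : ¬ IsGalois ℚ F) (ι : F →ₐ[ℚ] L)
include hL hF hFG ι

/-- **The conjugates of `ι(F)` generate `L`**: `⨆_φ φ(F) = ⊤` over all `φ : F →ₐ[ℚ] L` (already `ι(F) ⊔ σ(ι(F))` has degree a multiple of `3`
exceeding `3` and dividing `6`). [cite: MilneFT2022, Ch. 3] [cite: DavenportHeilbronn1971, §6] -/
theorem iSup_fieldRange_eq_top : (⨆ φ : F →ₐ[ℚ] L, φ.fieldRange) = ⊤ := by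
  obtain ⟨k, hk⟩ := exists_intermediateField_finrank_eq_two L hL
  obtain ⟨σ, τ, hσ3, hτ2, hτσ, hσk, hτF, -⟩ := exists_symmetricThree_pair_of_cubic L hL hF hFG ι k hk
  have hσk' : finrank ℚ ↥(fixedField (Subgroup.zpowers σ)) = 2 := by rw [hσk]; exact hk
  have hne := map_fieldRange_ne_of_pair L hL hF ι hτ2 hτσ hτF hσk'
  set M : IntermediateField ℚ L := ι.fieldRange ⊔ ((σ : L →ₐ[ℚ] L).comp ι).fieldRange with hM
  have hle : M ≤ ⨆ φ : F →ₐ[ℚ] L, φ.fieldRange :=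
    sup_le (le_iSup (fun φ : F →ₐ[ℚ] L ↦ φ.fieldRange) ι) (le_iSup (fun φ : F →ₐ[ℚ] L ↦ φ.fieldRange) _)
  have h3 : finrank ℚ ↥ι.fieldRange = 3 := by
    rw [← hF]; exact (LinearEquiv.finrank_eq (AlgEquiv.ofInjectiveField ι).toLinearEquiv).symm
  have h3' : finrank ℚ ↥((σ : L →ₐ[ℚ] L).comp ι).fieldRange = 3 := by
    rw [← hF]; exact (LinearEquiv.finrank_eq (AlgEquiv.ofInjectiveField ((σ : L →ₐ[ℚ] L).comp ι)).toLinearEquiv).symm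
  have hdvd3 : 3 ∣ finrank ℚ ↥M := h3 ▸ IntermediateField.finrank_dvd_of_le_right (le_sup_left : ι.fieldRange ≤ M)
  have hdvd6 : finrank ℚ ↥M ∣ 6 := by
    rw [← hL, ← IntermediateField.finrank_top' (F := ℚ) (E := L)]
    exact IntermediateField.finrank_dvd_of_le_right (le_top : M ≤ ⊤)
  -- `finrank M ∈ {3, 6}`; `3` would force `ι(F) = M = σ(ι(F))`
  have hM6 : finrank ℚ ↥M = 6 := by
    obtain ⟨c, hc⟩ := hdvd3
    have hc' : c ∣ 2 := by
      have : 3 * c ∣ 3 * 2 := by rw [← hc]; exact hdvd6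
      exact Nat.dvd_of_mul_dvd_mul_left (by norm_num) this
    rcases (Nat.dvd_prime Nat.prime_two).mp hc' with rfl | rfl
    · exfalso
      have hM3 : finrank ℚ ↥M = 3 := by rw [hc]
      have e1 : ι.fieldRange = M := IntermediateField.eq_of_le_of_finrank_eq le_sup_left (by rw [h3, hM3])
      have e2 : ((σ : L →ₐ[ℚ] L).comp ι).fieldRange = M := IntermediateField.eq_of_le_of_finrank_eq le_sup_right (by rw [h3', hM3])
      apply hne
      rw [AlgHom.map_fieldRange, e2, ← e1]
    · rw [hc]
  have hMtop : M = ⊤ := IntermediateField.eq_of_le_of_finrank_eq le_top (by rw [hM6, IntermediateField.finrank_top', hL])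
  exact top_le_iff.mp (hMtop ▸ hle)

/-- ★ **Every quadratic subfield of the Galois closure contains `√d_F ∉ ℚ`**: for `k ≤ L` with `[k:ℚ] = 2` there is `δ ∈ k`, `δ ∉ ℚ`, `δ² = d_F`
(`δ = det(φⱼ(xᵢ))` on an integral basis lies in the fixed field of the odd-order group `Gal(L/k)`, and is moved by some automorphism since the
permutation representation on the three embeddings is faithful with image `S₃ ⊄ A₃`). [cite: Ash2010, §2.3 (2.3.3) and Problem 1 (PDF p. 19)]
[cite: Marcus2018, Ch. 2 (discriminants and embeddings)] -/
theorem exists_sqrt_discr_mem_quadratic (k : IntermediateField ℚ L) (hk : finrank ℚ ↥k = 2) :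
    ∃ δ : L, δ ∈ k ∧ δ ^ 2 = ((discr F : ℤ) : L) ∧ δ ∉ Set.range (algebraMap ℚ L) := by
  classical
  have hcard := card_algHom_eq_finrank_of_isGalois L ι
  have hG : Nat.card (L ≃ₐ[ℚ] L) = 6 := by rw [IsGalois.card_aut_eq_finrank, hL]
  have hC : Nat.card k.fixingSubgroup = 3 := by
    rw [IsGalois.card_fixingSubgroup_eq_finrank]
    have h := finrank_mul_finrank ℚ ↥k L
    rw [hk, hL] at h
    omega
  have hodd : Odd (Nat.card k.fixingSubgroup) := by rw [hC]; exact ⟨1, rfl⟩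
  obtain ⟨δ, hδk, hδsq, hδQ⟩ := exists_sq_eq_discr_mem_fixedField_not_mem_range F L hcard (by rw [hF]; norm_num)
    (iSup_fieldRange_eq_top L hL hF hFG ι) (by rw [hF, hG]; decide) k.fixingSubgroup hodd
  rw [IsGalois.fixedField_fixingSubgroup] at hδk
  exact ⟨δ, hδk, hδsq, hδQ⟩

/-- ★ **THE DISCRIMINANT OF A NON-GALOIS CUBIC FIELD IS NOT A SQUARE** (given a Galois sextic receiving it: `√d_F ∈ L ∖ ℚ`).
[cite: Marcus2018, Ch. 2 (discriminants and embeddings)] [cite: Cohen1993, §6.3.3] -/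
theorem not_isSquare_discr_of_not_isGalois : ¬ IsSquare (discr F) := by
  obtain ⟨k, hk⟩ := exists_intermediateField_finrank_eq_two L hL
  obtain ⟨δ, -, hδsq, hδQ⟩ := exists_sqrt_discr_mem_quadratic L hL hF hFG ι k hk
  rintro ⟨r, hr⟩
  have h : δ ^ 2 = ((r : ℤ) : L) ^ 2 := by rw [hδsq, hr]; push_cast; ring
  rcases sq_eq_sq_iff_eq_or_eq_neg.mp h with h1 | h1
  · exact hδQ ⟨r, by rw [h1]; simp⟩
  · exact hδQ ⟨-r, by rw [h1]; simp⟩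

omit hL hF hFG ι in
/-- `2` is not the square of a rational number. [folklore] -/
private theorem not_isSquare_two_rat : ¬ IsSquare (2 : ℚ) := by
  rw [show (2 : ℚ) = ((2 : ℕ) : ℚ) by norm_num, Rat.isSquare_natCast_iff]
  rintro ⟨r, hr⟩
  have hr2 : r ≤ 2 := by nlinarith
  interval_cases r <;> omega

omit [IsGalois ℚ L] hL hF hFG ι in
/-- Elements of `ℚ(x)` for `x² ∈ ℚ` are `a + b·x` (`a, b ∈ ℚ`): reduce a polynomial in `x` modulo `X² − c`. [folklore] -/
private theorem exists_add_mul_of_mem_adjoin_of_sq {x : L} {c : ℚ} (hx : x ^ 2 = algebraMap ℚ L c) {y : L}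
    (hy : y ∈ ℚ⟮x⟯) : ∃ a b : ℚ, y = algebraMap ℚ L a + algebraMap ℚ L b * x := by
  have hmon : (X ^ 2 - C c : ℚ[X]).Monic := monic_X_pow_sub_C c two_ne_zero
  have hroot : aeval x (X ^ 2 - C c : ℚ[X]) = 0 := by simp [hx]
  have hint : IsIntegral ℚ x := ⟨_, hmon, by simpa [eval₂_eq_eval_map] using hroot⟩
  rw [← IntermediateField.mem_toSubalgebra, adjoin_simple_toSubalgebra_of_isAlgebraic hint.isAlgebraic,
    Algebra.adjoin_singleton_eq_range_aeval] at hy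
  obtain ⟨f, rfl⟩ := hy
  have hdeg : (f %ₘ (X ^ 2 - C c)).natDegree ≤ 1 := by
    have hne1 : (X ^ 2 - C c : ℚ[X]) ≠ 1 := fun h ↦ by
      have := congrArg natDegree h
      rw [natDegree_X_pow_sub_C, natDegree_one] at this
      omega
    have h := natDegree_modByMonic_lt f hmon hne1
    rw [natDegree_X_pow_sub_C] at h
    omega
  refine ⟨(f %ₘ (X ^ 2 - C c)).coeff 0, (f %ₘ (X ^ 2 - C c)).coeff 1, ?_⟩
  change aeval x f = _
  rw [← aeval_modByMonic_eq_self_of_root (p := f) hroot]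
  conv_lhs => rw [eq_X_add_C_of_natDegree_le_one hdeg]
  simp only [map_add, map_mul, aeval_C, aeval_X]
  ring

/-- ★ **`2·d_F ∉ ℚ² ⟹ √2 ∉ L`** for the Galois closure `L` of a non-Galois cubic field `F`: were `x² = 2` in `L`, the quadratic field `ℚ(x) ≤ L`
would contain `δ = a + bx ∉ ℚ` with `δ² = d_F`; comparing `ℚ`-parts forces `a = 0` and `2·d_F = (2b)²`.  This is the hypothesis `√2 ∉ L` of
`SymmetricThreeCubicClosureTowerExact` read on `F` alone (for complex cubics `d_F < 0` it is automatic). [cite: Marcus2018, Ch. 2 (discriminants and embeddings)]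
[cite: Washington1997, §13.1 (the layers `ℚ_n`, `ℚ_1 = ℚ(√2)`)] -/
theorem forall_sq_ne_two_of_not_isSquare_two_mul_discr (h2D : ¬ IsSquare (2 * (NumberField.discr F : ℚ))) : ∀ x : L, x ^ 2 ≠ 2 := by
  intro x hx
  have hinj : Function.Injective (algebraMap ℚ L) := (algebraMap ℚ L).injective
  have hx' : x ^ 2 = algebraMap ℚ L 2 := by rw [hx, map_ofNat]
  -- `x ∉ ℚ`
  have hxQ : x ∉ Set.range (algebraMap ℚ L) := by
    rintro ⟨q, rfl⟩
    refine not_isSquare_two_rat ⟨q, hinj ?_⟩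
    rw [map_mul, ← sq, hx, map_ofNat]
  -- `[ℚ(x) : ℚ] = 2`
  have hmon : (X ^ 2 - C (2 : ℚ) : ℚ[X]).Monic := monic_X_pow_sub_C _ two_ne_zero
  have hroot : aeval x (X ^ 2 - C (2 : ℚ) : ℚ[X]) = 0 := by simp [hx']
  have hint : IsIntegral ℚ x := ⟨_, hmon, by simpa [eval₂_eq_eval_map] using hroot⟩
  have hk2 : finrank ℚ ↥ℚ⟮x⟯ = 2 := by
    rw [IntermediateField.adjoin.finrank hint]
    have hirr : Irreducible (X ^ 2 - C (2 : ℚ) : ℚ[X]) := by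
      refine irreducible_of_degree_le_three_of_not_isRoot (by rw [natDegree_X_pow_sub_C]; decide) fun q hq ↦ ?_
      refine not_isSquare_two_rat ⟨q, ?_⟩
      have : q ^ 2 - 2 = 0 := by simpa using hq
      nlinarith [this]
    rw [← minpoly.eq_of_irreducible_of_monic hirr hroot hmon, natDegree_X_pow_sub_C]
  -- `√d_F = a + b x ∈ ℚ(x)`
  obtain ⟨δ, hδk, hδsq, hδQ⟩ := exists_sqrt_discr_mem_quadratic L hL hF hFG ι ℚ⟮x⟯ hk2
  obtain ⟨a, b, hab⟩ := exists_add_mul_of_mem_adjoin_of_sq L hx' hδk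
  have key : algebraMap ℚ L (2 * a * b) * x = algebraMap ℚ L ((NumberField.discr F : ℚ) - a ^ 2 - 2 * b ^ 2) := by
    have h1 : δ ^ 2 = algebraMap ℚ L (a ^ 2 + 2 * b ^ 2) + algebraMap ℚ L (2 * a * b) * x := by
      rw [hab]; simp only [map_add, map_mul, map_pow, map_ofNat]; linear_combination (algebraMap ℚ L b) ^ 2 * hx
    have h2 : δ ^ 2 = algebraMap ℚ L (NumberField.discr F : ℚ) := by rw [hδsq]; simp
    rw [map_sub, map_sub, ← h2, h1]; simp only [map_add, map_mul, map_pow, map_ofNat]; ring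
  by_cases hab0 : 2 * a * b = 0
  · -- `a = 0` or `b = 0`
    rcases mul_eq_zero.mp hab0 with ha | hb
    · have ha' : a = 0 := by simpa using ha
      -- `δ = b x`, `d_F = 2 b²`
      rw [ha', map_zero, zero_add] at hab
      apply h2D
      refine ⟨2 * b, ?_⟩
      have h3 : algebraMap ℚ L (NumberField.discr F : ℚ) = algebraMap ℚ L (2 * b ^ 2) := by
        have h2 : δ ^ 2 = algebraMap ℚ L (NumberField.discr F : ℚ) := by rw [hδsq]; simp
        rw [← h2, hab, mul_pow, hx', ← map_pow, ← map_mul]; ring_nf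
      have h4 : (NumberField.discr F : ℚ) = 2 * b ^ 2 := hinj h3
      rw [h4]; ring
    · rw [hb, map_zero, zero_mul, add_zero] at hab
      exact hδQ ⟨a, hab.symm⟩
  · -- `x ∈ ℚ`: absurd
    apply hxQ
    refine ⟨((NumberField.discr F : ℚ) - a ^ 2 - 2 * b ^ 2) / (2 * a * b), ?_⟩
    rw [map_div₀, ← key, mul_comm, mul_div_assoc, div_self ((_root_.map_ne_zero _).mpr hab0), mul_one]

/-- ★ **The quadratic resolvent is `ℚ(√d_F)`**: every quadratic subfield `k ≤ L` equals `ℚ⟮δ⟯` for some `δ` with `δ² = d_F` — in particular the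
Galois closure of a non-Galois cubic field has a UNIQUE quadratic subfield. [cite: Marcus2018, Ch. 2 (discriminants and embeddings)]
[cite: DavenportHeilbronn1971, §6 (K₂ = ℚ(√d))] -/
theorem quadratic_eq_adjoin_sqrt_discr (k : IntermediateField ℚ L) (hk : finrank ℚ ↥k = 2) :
    ∃ δ : L, δ ^ 2 = ((discr F : ℤ) : L) ∧ k = ℚ⟮δ⟯ := by
  obtain ⟨δ, hδk, hδsq, hδQ⟩ := exists_sqrt_discr_mem_quadratic L hL hF hFG ι k hk
  refine ⟨δ, hδsq, ?_⟩
  have hle : ℚ⟮δ⟯ ≤ k := adjoin_simple_le_iff.mpr hδk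
  -- `[ℚ(δ) : ℚ] = 2`
  have hδsq' : δ ^ 2 = algebraMap ℚ L (NumberField.discr F : ℚ) := by rw [hδsq]; simp
  have hmon : (X ^ 2 - C ((NumberField.discr F : ℤ) : ℚ) : ℚ[X]).Monic := monic_X_pow_sub_C _ two_ne_zero
  have hroot : aeval δ (X ^ 2 - C ((NumberField.discr F : ℤ) : ℚ) : ℚ[X]) = 0 := by simp [hδsq']
  have hint : IsIntegral ℚ δ := ⟨_, hmon, by simpa [eval₂_eq_eval_map] using hroot⟩
  have hk2 : finrank ℚ ↥ℚ⟮δ⟯ = 2 := by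
    rw [IntermediateField.adjoin.finrank hint]
    have hirr : Irreducible (X ^ 2 - C ((NumberField.discr F : ℤ) : ℚ) : ℚ[X]) := by
      refine irreducible_of_degree_le_three_of_not_isRoot (by rw [natDegree_X_pow_sub_C]; decide) fun q hq ↦ ?_
      have hq' : q ^ 2 = (NumberField.discr F : ℚ) := by
        have : q ^ 2 - (NumberField.discr F : ℚ) = 0 := by simpa using hq
        linarith
      have h : δ ^ 2 = (algebraMap ℚ L q) ^ 2 := by rw [hδsq', ← map_pow, hq']
      rcases sq_eq_sq_iff_eq_or_eq_neg.mp h with h1 | h1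
      · exact hδQ ⟨q, h1.symm⟩
      · exact hδQ ⟨-q, by rw [h1, map_neg]⟩
    rw [← minpoly.eq_of_irreducible_of_monic hirr hroot hmon, natDegree_X_pow_sub_C]
  exact (IntermediateField.eq_of_le_of_finrank_eq hle (by rw [hk2, hk])).symm

/-- **Uniqueness of the quadratic subfield** of the Galois closure of a non-Galois cubic field. [cite: Marcus2018, Ch. 2] [cite: DavenportHeilbronn1971, §6] -/
theorem quadratic_subfield_unique (k k' : IntermediateField ℚ L) (hk : finrank ℚ ↥k = 2) (hk' : finrank ℚ ↥k' = 2) : k = k' := by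
  obtain ⟨δ, hδsq, rfl⟩ := quadratic_eq_adjoin_sqrt_discr L hL hF hFG ι k hk
  obtain ⟨δ', hδ'sq, rfl⟩ := quadratic_eq_adjoin_sqrt_discr L hL hF hFG ι k' hk'
  have h : δ ^ 2 = δ' ^ 2 := by rw [hδsq, hδ'sq]
  rcases sq_eq_sq_iff_eq_or_eq_neg.mp h with h1 | h1
  · rw [h1]
  · rw [h1]
    apply le_antisymm
    · exact adjoin_simple_le_iff.mpr (neg_mem (mem_adjoin_simple_self ℚ δ'))
    · refine adjoin_simple_le_iff.mpr ?_
      simpa using neg_mem (mem_adjoin_simple_self ℚ (-δ'))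

/-! ### §2 The exact `S₃` relation with every hypothesis read on the cubic field `F` -/

/-- ★★ **`e_n(L) = e_n(k) + 2·e_n(F)` with hypotheses on `F` alone**: `F` a cubic number field, not Galois over `ℚ`, with `2·d_F ∉ ℚ²`; `L` ANY Galois
sextic receiving `F`, `k ≤ L` ANY quadratic subfield (`= ℚ(√d_F)`, §1); `κ_L, κ_k, κ_F` ANY cyclotomic `ℤ₂`-extensions. (For complex cubics `d_F < 0`,
so `2·d_F ∉ ℚ²` automatically.) [cite: CaputoNuccio2020, Prop. 3.12] [cite: Bartel2012, Cor. 5.2] [cite: Washington1997, §13.1 and Thm. 10.4] -/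
theorem classNumberPExp_galoisClosure_eq_resolvent_add_two_mul_cubic_of_discr (h2D : ¬ IsSquare (2 * (NumberField.discr F : ℚ)))
    (k : IntermediateField ℚ L) (hk : finrank ℚ ↥k = 2)
    (κL : ZpExtension L 2) (hκL : κL.IsCyclotomic) (κk : ZpExtension ↥k 2) (hκk : κk.IsCyclotomic)
    (κF : ZpExtension F 2) (hκF : κF.IsCyclotomic) (n : ℕ) :
    classNumberPExp κL n = classNumberPExp κk n + 2 * classNumberPExp κF n :=
  classNumberPExp_galoisClosure_eq_resolvent_add_two_mul_cubic hF hFG L hL ι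
    (forall_sq_ne_two_of_not_isSquare_two_mul_discr L hL hF hFG ι h2D) k hk κL hκL κk hκk κF hκF n

/-- ★ **`μ₂(L) = 0 ⟺ μ₂(F) = 0`** (growth form) for every non-Galois cubic `F` with `2·d_F ∉ ℚ²` and every Galois sextic `L ⊇ ι(F)`.
[cite: CaputoNuccio2020, Prop. 3.12] [cite: Washington1997, §13.3 Thm. 13.13] [cite: FerreroWashington1979, Thm.] -/
theorem classicalMuVanishes_galoisClosure_iff_cubic_of_discr (h2D : ¬ IsSquare (2 * (NumberField.discr F : ℚ)))
    (κL : ZpExtension L 2) (hκL : κL.IsCyclotomic) (κF : ZpExtension F 2) (hκF : κF.IsCyclotomic) :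
    ClassicalMuVanishes κL ↔ ClassicalMuVanishes κF :=
  classicalMuVanishes_galoisClosure_iff_cubic hF hFG L hL ι (forall_sq_ne_two_of_not_isSquare_two_mul_discr L hL hF hFG ι h2D) κL hκL κF hκF

/-- ★ **`λ₂(L) = λ₂(ℚ(√d_F)) + 2·λ₂(F)`** for every non-Galois cubic `F` with `2·d_F ∉ ℚ²` and `μ₂(F) = 0`, every Galois sextic `L ⊇ ι(F)`, and its (unique)
quadratic subfield `k = ℚ(√d_F)`. [cite: CaputoNuccio2020, Prop. 3.12] [cite: Washington1997, §13.3 Thm. 13.13] -/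
theorem classicalLambda_galoisClosure_eq_of_discr (h2D : ¬ IsSquare (2 * (NumberField.discr F : ℚ)))
    (k : IntermediateField ℚ L) (hk : finrank ℚ ↥k = 2)
    (κL : ZpExtension L 2) (hκL : κL.IsCyclotomic) (κk : ZpExtension ↥k 2) (hκk : κk.IsCyclotomic)
    (κF : ZpExtension F 2) (hκF : κF.IsCyclotomic) (hμF : ClassicalMuVanishes κF) :
    classicalLambda κL = classicalLambda κk + 2 * classicalLambda κF :=
  classicalLambda_galoisClosure_eq_resolvent_add_two_mul_cubic hF hFG L hL ι
    (forall_sq_ne_two_of_not_isSquare_two_mul_discr L hL hF hFG ι h2D) k hk κL hκL κk hκk κF hκF hμF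

end Resolvent

end Literature.NumberTheory.IwasawaTheory

end
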